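import Mathlib.Analysis.Calculus.FDeriv.Mul
import Mathlib.Analysis.Calculus.Deriv.Comp
import Mathlib.Analysis.Calculus.Deriv.Mul
import Mathlib.Analysis.Analytic.Order
import Literature.Analysis.OperatorTheory.CoercivePencilResolvent
import HarnessLib

/-!
# Rank-one–modified pencils: range criterion, Jordan chains, and «simple zero of the Evans function ⇒
# algebraically simple eigenvalue» — without Gohberg–Sigal

`Literature/Analysis/OperatorTheory`; proofs-layer file (theorems only; no definitions, no named facts).  Companion of
`CoercivePencilResolvent.lean` (§3–§4 there: the KERNEL criterion `ker(P − ℓ(·)f) ≠ 0 ⇔ ℓ(P⁻¹f) = 1` and the analyticity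
of the Evans function `E(σ) = 1 − θ ℓ((A + σK)⁻¹ f)`).  Here: the elementary rank-one substitute for the
«order of the zero of `E` = algebraic multiplicity of the eigenvalue» step (Gohberg–Sigal 1971 / Keldysh) that a
spectral certificate needs in order to say «ALGEBRAICALLY SIMPLE» after it has certified that `E` has a SIMPLE zero.

**§A (algebra, any normed field).**  `P` with two-sided inverse `R`, `Q u := P u − ℓ(u) f`, in the singular case
`ℓ(R f) = 1`: the kernel of `Q` is the line through `R f` (`rankOne_kernel_iff_smul`); the RANGE criterion
`(∃ x, Q x = y) ⇔ ℓ(R y) = 0` (`rankOne_range_iff`); hence for any `K` the JORDAN-CHAIN criterion for the linear pencil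
`σ ↦ Q + (σ − σ₀)K` at `σ₀`: `(∃ δ₁, Q δ₁ = −K(R f)) ⇔ ℓ(R K R f) = 0` (`rankOne_jordanChain_iff`)
[cite: Kato1966, III-§4.3, (4.13) and III-§6.5 (degenerate perturbations; the reduction to a determinant)].

**§B (calculus).**  With `R(σ) := Ring.inverse (A + σK)` and `A + σ₀K` a unit: `R′(σ₀) = −R₀ K R₀`
(`hasDerivAt_ring_inverse_pencil`; Mathlib's `hasFDerivAt_ringInverse`) and
`E′(σ₀) = θ ℓ(R₀ K R₀ f)` (`hasDerivAt_evans`, `deriv_evans`) [cite: Kato1966, II-§1.3 and VII-§1.1 (the resolvent of a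
holomorphic family is holomorphic; first-order term)].

**§C (the certificate's sentence).**  If `E(σ₀) = 0` and `E′(σ₀) ≠ 0` (a SIMPLE zero — e.g. from `analyticOrderAt E σ₀ = 1`,
`deriv_ne_zero_of_analyticOrderAt_eq_one`) then for `T₀ := A + σ₀K − θ ℓ(·) f` (`= DG + σ₀J` when `A = DG + θ ℓ(·) f`):
the kernel of `T₀` is the line through `R₀ f ≠ 0` and NO kernel vector `δ₀ ≠ 0` admits a generalized eigenvector,
`¬ ∃ δ₁, T₀ δ₁ = −K δ₀` — geometric AND algebraic multiplicity one for the linear pencil `σ ↦ T₀ + (σ − σ₀)K`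
(`pencil_rankOne_kernel_line_of_evans_zero`, `pencil_rankOne_no_jordanChain_of_deriv_ne_zero`,
`pencil_rankOne_algebraically_simple`) [cite: Kato1966, III-§6.5 and IV-§1.4 Thm. 1.16, elementary rank-one case].

MOTIVATION (provenance only): cell ns-blowup, zone Z3, case Z3-SR-SPEC (profile-lead RULING (dx)(4): the PASS word's clause
«`σ_p(−DG(Ω*)|_E) ∩ {Re σ ≥ −0.03} = {1}` = the T-shift gauge mode, SIMPLE», where the certificate delivers winding = 1 for
`E` on `∂D` and `E(1) = 0`; with the tree's argument principle that is `analyticOrderAt E 1 = 1`, and this file turns it into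
«no generalized eigenvector at `σ = 1`» by decl name).  WHAT THIS IS NOT: nothing about Navier–Stokes or Euler; abstract
linear algebra and one-variable calculus.

## References
* [Kato1966] T. Kato, *Perturbation Theory for Linear Operators*, Springer 1966, II-§1.3, III-§4.3 (4.13), III-§6.5,
  IV-§1.4 Thm. 1.16, VII-§1.1.
* I. Gohberg, E. I. Sigal, *An operator generalization of the logarithmic residue theorem and the theorem of Rouché*,
  Math. USSR Sb. 13 (1971) 603–625 — the general statement this file avoids (prose reference only).
-/

noncomputable section

open scoped InnerProductSpace
open RCLike

namespace Literature.Analysis.OperatorTheory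

/-! ### §A Kernel line, range criterion and Jordan chains of a rank-one–modified invertible operator -/

section Algebra

variable {𝕜 : Type*} [NontriviallyNormedField 𝕜]
variable {E : Type*} [NormedAddCommGroup E] [NormedSpace 𝕜 E]

/-- In the singular case `ℓ(R f) = 1` the kernel of `Q u = P u − ℓ(u) f` is exactly the line through `R f`.
[cite: Kato1966, III-§4.3, (4.13) (degenerate perturbation of rank one; the singular case)] -/
theorem rankOne_kernel_iff_smul (P R : E →L[𝕜] E) (hPR : ∀ v, P (R v) = v) (hRP : ∀ u, R (P u) = u)
    (f : E) (ℓ : E →L[𝕜] 𝕜) (h : ℓ (R f) = 1) (u : E) :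
    (P - ℓ.smulRight f) u = 0 ↔ ∃ t : 𝕜, u = t • R f := by
  constructor
  · intro hQ
    rcases eq_or_ne u 0 with h0 | h0
    · exact ⟨0, by simp [h0]⟩
    · exact ⟨ℓ u, (evans_eq_one_of_rankOne_kernel P R hRP f ℓ hQ h0).2.1⟩
  · rintro ⟨t, rfl⟩
    rw [map_smul, (rankOne_apply_inverse_eq_zero P R hPR f ℓ h).1, smul_zero]

/-- **Range criterion** in the singular case `ℓ(R f) = 1`: `Q x = y` is solvable iff `ℓ(R y) = 0` (and then `x = R y`
is a solution). [cite: Kato1966, III-§4.3, (4.13) and III-§6.5 (degenerate perturbations)] -/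
theorem rankOne_range_iff (P R : E →L[𝕜] E) (hPR : ∀ v, P (R v) = v) (hRP : ∀ u, R (P u) = u)
    (f : E) (ℓ : E →L[𝕜] 𝕜) (h : ℓ (R f) = 1) (y : E) :
    (∃ x, (P - ℓ.smulRight f) x = y) ↔ ℓ (R y) = 0 := by
  constructor
  · rintro ⟨x, hx⟩
    have h1 : R ((P - ℓ.smulRight f) x) = R y := by rw [hx]
    have h2 : R ((P - ℓ.smulRight f) x) = x - ℓ x • R f := by
      simp [ContinuousLinearMap.smulRight_apply, map_sub, map_smul, hRP]
    have h3 := congrArg ℓ (h2.symm.trans h1)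
    simp only [map_sub, map_smul, smul_eq_mul, h, mul_one, sub_self] at h3
    exact h3.symm
  · intro hy
    refine ⟨R y, ?_⟩
    simp [ContinuousLinearMap.smulRight_apply, hPR, hy]

/-- **Jordan-chain criterion** for the linear pencil `σ ↦ Q + (σ − σ₀)K` at `σ₀` in the singular case `ℓ(R f) = 1`
(kernel vector `R f`): a generalized eigenvector `δ₁` with `Q δ₁ = −K (R f)` exists iff `ℓ(R K R f) = 0`.
[cite: Kato1966, III-§6.5 (the reduction of a degenerate perturbation to a determinant), elementary rank-one case] -/
theorem rankOne_jordanChain_iff (P R : E →L[𝕜] E) (hPR : ∀ v, P (R v) = v) (hRP : ∀ u, R (P u) = u)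
    (K : E →L[𝕜] E) (f : E) (ℓ : E →L[𝕜] 𝕜) (h : ℓ (R f) = 1) :
    (∃ δ₁, (P - ℓ.smulRight f) δ₁ = -(K (R f))) ↔ ℓ (R (K (R f))) = 0 := by
  rw [rankOne_range_iff P R hPR hRP f ℓ h, map_neg, map_neg, neg_eq_zero]

/-- The same criterion for an arbitrary nonzero kernel vector `δ₀` (a nonzero multiple of `R f`).
[cite: Kato1966, III-§6.5, elementary rank-one case] -/
theorem rankOne_jordanChain_iff_of_kernel (P R : E →L[𝕜] E) (hPR : ∀ v, P (R v) = v) (hRP : ∀ u, R (P u) = u)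
    (K : E →L[𝕜] E) (f : E) (ℓ : E →L[𝕜] 𝕜) (h : ℓ (R f) = 1) {δ₀ : E}
    (hδ : (P - ℓ.smulRight f) δ₀ = 0) (hδ0 : δ₀ ≠ 0) :
    (∃ δ₁, (P - ℓ.smulRight f) δ₁ = -(K δ₀)) ↔ ℓ (R (K (R f))) = 0 := by
  obtain ⟨-, hu, ht⟩ := evans_eq_one_of_rankOne_kernel P R hRP f ℓ hδ hδ0
  set t := ℓ δ₀ with ht'
  rw [← rankOne_jordanChain_iff P R hPR hRP K f ℓ h]
  constructor
  · rintro ⟨δ₁, h1⟩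
    refine ⟨t⁻¹ • δ₁, ?_⟩
    rw [map_smul, h1, hu, map_smul, smul_neg, smul_smul, inv_mul_cancel₀ ht, one_smul]
  · rintro ⟨δ₁, h1⟩
    refine ⟨t • δ₁, ?_⟩
    rw [map_smul, h1, hu, map_smul, smul_neg]

end Algebra

/-! ### §B The derivative of the resolvent of the pencil and of the Evans function -/

section Calculus

variable {𝕜 : Type*} [NontriviallyNormedField 𝕜]
variable {E : Type*} [NormedAddCommGroup E] [NormedSpace 𝕜 E] [CompleteSpace E]

/-- `d/dσ (A + σK)⁻¹ = −R₀ K R₀` at a point `σ₀` where the pencil is a unit, `R₀ = (A + σ₀K)⁻¹`.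
[cite: Kato1966, II-§1.3 and VII-§1.1 (first-order term of the resolvent of a holomorphic family)] -/
theorem hasDerivAt_ring_inverse_pencil (A K : E →L[𝕜] E) {σ₀ : 𝕜} (hU : IsUnit (A + σ₀ • K)) :
    HasDerivAt (fun σ : 𝕜 => Ring.inverse (A + σ • K))
      (-(Ring.inverse (A + σ₀ • K) * K * Ring.inverse (A + σ₀ • K))) σ₀ := by
  obtain ⟨u, hu⟩ := hU
  have h1 : HasDerivAt (fun σ : 𝕜 => A + σ • K) K σ₀ := by
    simpa using ((hasDerivAt_id σ₀).smul_const K).const_add A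
  have h2 : HasFDerivAt Ring.inverse (-ContinuousLinearMap.mulLeftRight 𝕜 (E →L[𝕜] E) ↑u⁻¹ ↑u⁻¹) (A + σ₀ • K) := by
    rw [← hu]; exact hasFDerivAt_ringInverse u
  have h3 := h2.comp_hasDerivAt σ₀ h1
  have hR : Ring.inverse (A + σ₀ • K) = ↑u⁻¹ := by rw [← hu, Ring.inverse_unit]
  rw [hR]
  simpa [Function.comp_def] using h3

/-- **The derivative of the Evans function**: `E(σ) = 1 − θ ℓ((A + σK)⁻¹ f)` has `E′(σ₀) = θ ℓ(R₀ K R₀ f)`.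
[cite: Kato1966, II-§1.3 and VII-§1.1, elementary case] -/
theorem hasDerivAt_evans (A K : E →L[𝕜] E) (ℓ : E →L[𝕜] 𝕜) (f : E) (θ : 𝕜) {σ₀ : 𝕜}
    (hU : IsUnit (A + σ₀ • K)) :
    HasDerivAt (fun σ : 𝕜 => 1 - θ * ℓ (Ring.inverse (A + σ • K) f))
      (θ * ℓ (Ring.inverse (A + σ₀ • K) (K (Ring.inverse (A + σ₀ • K) f)))) σ₀ := by
  set R₀ := Ring.inverse (A + σ₀ • K) with hR₀
  have h1 := hasDerivAt_ring_inverse_pencil A K hU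
  -- `T ↦ ℓ (T f)` is a bounded linear functional on `E →L[𝕜] E`
  set φ : (E →L[𝕜] E) →L[𝕜] 𝕜 := ℓ.comp (ContinuousLinearMap.apply 𝕜 E f) with hφ
  have h2 : HasDerivAt (fun σ : 𝕜 => φ (Ring.inverse (A + σ • K))) (φ (-(R₀ * K * R₀))) σ₀ :=
    φ.hasFDerivAt.comp_hasDerivAt σ₀ h1
  have h3 : ∀ T : E →L[𝕜] E, φ T = ℓ (T f) := fun T => rfl
  have h4 : φ (-(R₀ * K * R₀)) = -ℓ (R₀ (K (R₀ f))) := by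
    rw [map_neg, h3]; rfl
  have h5 : HasDerivAt (fun σ : 𝕜 => ℓ (Ring.inverse (A + σ • K) f)) (-ℓ (R₀ (K (R₀ f)))) σ₀ := by
    simpa [h3, h4] using h2
  have h6 := (h5.const_mul θ).const_sub 1
  simpa using h6

/-- `deriv` form of `hasDerivAt_evans`. [cite: Kato1966, II-§1.3 and VII-§1.1, elementary case] -/
theorem deriv_evans (A K : E →L[𝕜] E) (ℓ : E →L[𝕜] 𝕜) (f : E) (θ : 𝕜) {σ₀ : 𝕜} (hU : IsUnit (A + σ₀ • K)) :
    deriv (fun σ : 𝕜 => 1 - θ * ℓ (Ring.inverse (A + σ • K) f)) σ₀ =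
      θ * ℓ (Ring.inverse (A + σ₀ • K) (K (Ring.inverse (A + σ₀ • K) f))) :=
  (hasDerivAt_evans A K ℓ f θ hU).deriv

end Calculus

/-! ### §C Simple zero of the Evans function ⇒ geometrically and algebraically simple eigenvalue -/

section Simple

variable {𝕜 : Type*} [NontriviallyNormedField 𝕜]
variable {E : Type*} [NormedAddCommGroup E] [NormedSpace 𝕜 E] [CompleteSpace E]

omit [CompleteSpace E] in
/-- At a zero `σ₀` of the Evans function inside the region where the pencil is a unit, the kernel of
`T₀ = A + σ₀K − θ ℓ(·) f` is the line through `R₀ f ≠ 0`, `R₀ = (A + σ₀K)⁻¹` (geometric multiplicity one).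
[cite: Kato1966, III-§4.3, (4.13) and IV-§1.4 Thm. 1.16, elementary rank-one case] -/
theorem pencil_rankOne_kernel_line_of_evans_zero (A K : E →L[𝕜] E) (ℓ : E →L[𝕜] 𝕜) (f : E) (θ : 𝕜)
    {σ₀ : 𝕜} (hU : IsUnit (A + σ₀ • K)) (hE : 1 - θ * ℓ (Ring.inverse (A + σ₀ • K) f) = 0) :
    Ring.inverse (A + σ₀ • K) f ≠ 0 ∧
      ∀ u, (A + σ₀ • K - (θ • ℓ).smulRight f) u = 0 ↔ ∃ t : 𝕜, u = t • Ring.inverse (A + σ₀ • K) f := by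
  have hPR : ∀ v, (A + σ₀ • K) (Ring.inverse (A + σ₀ • K) v) = v := fun v => by
    simpa using congrArg (fun T : E →L[𝕜] E => T v) (Ring.mul_inverse_cancel _ hU)
  have hRP : ∀ u, Ring.inverse (A + σ₀ • K) ((A + σ₀ • K) u) = u := fun u => by
    simpa using congrArg (fun T : E →L[𝕜] E => T u) (Ring.inverse_mul_cancel _ hU)
  have h1 : (θ • ℓ) (Ring.inverse (A + σ₀ • K) f) = 1 := by
    rw [smul_apply, smul_eq_mul]; exact (sub_eq_zero.1 hE).symm
  exact ⟨(rankOne_apply_inverse_eq_zero _ _ hPR f (θ • ℓ) h1).2,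
    fun u => rankOne_kernel_iff_smul _ _ hPR hRP f (θ • ℓ) h1 u⟩

/-- **No generalized eigenvector at a simple zero.**  If `E(σ₀) = 0` and `E′(σ₀) ≠ 0` then no nonzero kernel vector
`δ₀` of `T₀ = A + σ₀K − θ ℓ(·) f` has a `δ₁` with `T₀ δ₁ = −K δ₀` (no Jordan chain of length two for the linear pencil
`σ ↦ T₀ + (σ − σ₀)K`). [cite: Kato1966, III-§6.5 and IV-§1.4 Thm. 1.16, elementary rank-one case] -/
theorem pencil_rankOne_no_jordanChain_of_deriv_ne_zero (A K : E →L[𝕜] E) (ℓ : E →L[𝕜] 𝕜) (f : E) (θ : 𝕜)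
    {σ₀ : 𝕜} (hU : IsUnit (A + σ₀ • K)) (hE : 1 - θ * ℓ (Ring.inverse (A + σ₀ • K) f) = 0)
    (hE' : deriv (fun σ : 𝕜 => 1 - θ * ℓ (Ring.inverse (A + σ • K) f)) σ₀ ≠ 0)
    {δ₀ : E} (hδ : (A + σ₀ • K - (θ • ℓ).smulRight f) δ₀ = 0) (hδ0 : δ₀ ≠ 0) :
    ¬ ∃ δ₁, (A + σ₀ • K - (θ • ℓ).smulRight f) δ₁ = -(K δ₀) := by
  have hPR : ∀ v, (A + σ₀ • K) (Ring.inverse (A + σ₀ • K) v) = v := fun v => by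
    simpa using congrArg (fun T : E →L[𝕜] E => T v) (Ring.mul_inverse_cancel _ hU)
  have hRP : ∀ u, Ring.inverse (A + σ₀ • K) ((A + σ₀ • K) u) = u := fun u => by
    simpa using congrArg (fun T : E →L[𝕜] E => T u) (Ring.inverse_mul_cancel _ hU)
  have h1 : (θ • ℓ) (Ring.inverse (A + σ₀ • K) f) = 1 := by
    rw [smul_apply, smul_eq_mul]; exact (sub_eq_zero.1 hE).symm
  rw [rankOne_jordanChain_iff_of_kernel _ _ hPR hRP K f (θ • ℓ) h1 hδ hδ0, smul_apply, smul_eq_mul,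
    ← deriv_evans A K ℓ f θ hU]
  exact hE'

/-- The bridge from the certificate's count: for an analytic scalar function, `analyticOrderAt g σ₀ = 1` with
`g σ₀ = 0` forces `deriv g σ₀ ≠ 0`. [cite: Kato1966, II-§1.3 (order of a zero), elementary] -/
theorem deriv_ne_zero_of_analyticOrderAt_eq_one {𝕜 : Type*} [RCLike 𝕜] {g : 𝕜 → 𝕜} {σ₀ : 𝕜}
    (hg : AnalyticAt 𝕜 g σ₀) (h0 : g σ₀ = 0) (h1 : analyticOrderAt g σ₀ = 1) : deriv g σ₀ ≠ 0 := by
  have h2 := hg.analyticOrderAt_deriv_add_one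
  have h3 : (fun z => g z - g σ₀) = g := by funext z; rw [h0, sub_zero]
  rw [h3, h1] at h2
  have h4 : analyticOrderAt (deriv g) σ₀ = 0 := by
    have h5 : analyticOrderAt (deriv g) σ₀ ≠ ⊤ := by
      intro htop; rw [htop] at h2; exact absurd h2 (by simp)
    obtain ⟨n, hn⟩ := ENat.ne_top_iff_exists.1 h5
    rw [← hn] at h2 ⊢
    have h6 : (n : ℕ∞) + 1 = ((n + 1 : ℕ) : ℕ∞) := by push_cast; rfl
    rw [h6] at h2
    have h7 : n + 1 = 1 := by exact_mod_cast h2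
    have h8 : n = 0 := by omega
    simp [h8]
  exact (hg.deriv.analyticOrderAt_eq_zero).1 h4

/-- **The certificate's sentence** (`𝕜 = ℝ` or `ℂ`): if the Evans function `E(σ) = 1 − θ ℓ((A + σK)⁻¹ f)` vanishes at
`σ₀` to order EXACTLY one (what «winding = 1 around a region containing the known zero `σ₀`» gives through the argument
principle) and the pencil is a unit at `σ₀`, then `σ₀` is a geometrically AND algebraically simple eigenvalue of the
linear pencil `σ ↦ A + σK − θ ℓ(·) f`: the kernel at `σ₀` is the line through `R₀ f ≠ 0` and no nonzero kernel vector
has a generalized eigenvector. [cite: Kato1966, III-§6.5 and IV-§1.4 Thm. 1.16, elementary rank-one case] -/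
theorem pencil_rankOne_algebraically_simple {𝕜 : Type*} [RCLike 𝕜] {E : Type*} [NormedAddCommGroup E]
    [InnerProductSpace 𝕜 E] [CompleteSpace E] (A K : E →L[𝕜] E) (ℓ : E →L[𝕜] 𝕜) (f : E) (θ : 𝕜) {σ₀ : 𝕜}
    (hU : IsUnit (A + σ₀ • K))
    (hE1 : analyticOrderAt (fun σ : 𝕜 => 1 - θ * ℓ (Ring.inverse (A + σ • K) f)) σ₀ = 1) :
    (Ring.inverse (A + σ₀ • K) f ≠ 0 ∧
      ∀ u, (A + σ₀ • K - (θ • ℓ).smulRight f) u = 0 ↔ ∃ t : 𝕜, u = t • Ring.inverse (A + σ₀ • K) f) ∧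
    ∀ δ₀, δ₀ ≠ 0 → (A + σ₀ • K - (θ • ℓ).smulRight f) δ₀ = 0 →
      ¬ ∃ δ₁, (A + σ₀ • K - (θ • ℓ).smulRight f) δ₁ = -(K δ₀) := by
  have hE : AnalyticAt 𝕜 (fun σ : 𝕜 => 1 - θ * ℓ (Ring.inverse (A + σ • K) f)) σ₀ := analyticAt_evans A K ℓ f θ hU
  -- a zero of positive order is a zero
  have h0 : 1 - θ * ℓ (Ring.inverse (A + σ₀ • K) f) = 0 := by
    have hpos : 0 < analyticOrderAt (fun σ : 𝕜 => 1 - θ * ℓ (Ring.inverse (A + σ • K) f)) σ₀ := by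
      rw [hE1]; exact zero_lt_one
    by_contra hne
    have := (hE.analyticOrderAt_eq_zero).2 hne
    rw [this] at hpos; exact lt_irrefl _ hpos
  have hd := deriv_ne_zero_of_analyticOrderAt_eq_one hE h0 hE1
  exact ⟨pencil_rankOne_kernel_line_of_evans_zero A K ℓ f θ hU h0,
    fun δ₀ hδ0 hδ => pencil_rankOne_no_jordanChain_of_deriv_ne_zero A K ℓ f θ hU h0 hd hδ hδ0⟩

end Simple

end Literature.Analysis.OperatorTheory
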